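import Summits.Ventures.HodgeRepro2.T5LandherrGeneral
import Summits.Ventures.HodgeRepro2.T5GlobalRepresentationHM

/-!
# Landherr's theorem — the Hasse principle for hermitian forms over a CM field — in EVERY rank, from O'Meara's
66:1 ALONE (cell pub-hodge-repro2, seat p3)

Tier-5 N2 support, rows N2.2.7 / N2.2.9 / N2.8.1 of route/T5-N2-route-3.md. File 173 proved
`grossBH2021_of_OMeara : OMeara1963_66_1 K⁺ → OMeara1963_63_19 K⁺ → GrossBH2021_Thm3_1_uniqueness K n` by the
classical Witt-type induction, with the representation step supplied by file 171 — the ONLY place where the display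
of 63:19 entered. File 176 (T5GlobalRepresentationHM) supplies that step from `OMeara1963_66_1 K⁺` alone (the local
isotropy of the `(2n+1)`-ary space being file 175's kernel lemma), and this file is file 173's proof, verbatim,
on file 176's theorem:
* **`isCongruent_diagonal_of_OMeara66_1_of_card`** — the induction on the rank for diagonal forms;
* **`grossBH2021_of_OMeara66_1`** — `OMeara1963_66_1 K⁺ → GrossBH2021_Thm3_1_uniqueness K n` for EVERY finite
  index type `n`: the uniqueness clause of Landherr's theorem (Gross 2021 Thm 3.1, last sentence; Shimura 2008
  Thm 2.2 (i)) over every CM field, in every rank, is a kernel consequence of the Hasse–Minkowski theorem as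
  printed (O'Meara 66:1, isotropy form, «if» half) and nothing else.

Mathlib + this seat's files 173 / 176 and their imports; no new display; no device.
§8(d): uses an L-value-free non-vanishing device: NO.
-/

namespace Summit.Ventures.HodgeRepro2.T5LandherrGeneralHM

open Matrix Finset NumberField NumberField.IsCMField IsDedekindDomain IsDedekindDomain.HeightOneSpectrum
open Summit.Ventures.HodgeRepro2.T5HasseMinkowskiDisplays Summit.Ventures.HodgeRepro2.T5HermitianDiagonalSign
  Summit.Ventures.HodgeRepro2.T5GlobalRepresentation Summit.Ventures.HodgeRepro2.T5HasseNormOfHasseMinkowski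
  Summit.Ventures.HodgeRepro2.T5LandherrInvariants Summit.Ventures.HodgeRepro2.T5LandherrInvariantsIff
  Summit.Ventures.HodgeRepro2.T5HermitianGlobalChain Summit.Ventures.HodgeRepro2.T5HermitianDetClass
  Summit.Ventures.HodgeRepro2.T5HermitianDiagonalize Summit.Ventures.HodgeRepro2.T5HermitianClassify
  Summit.Ventures.HodgeRepro2.T5FinitePlaceSplitClassification Summit.Ventures.HodgeRepro2.T5GramSignature
  Summit.Ventures.HodgeRepro2.T5LandherrRankOne Summit.Ventures.HodgeRepro2.T6.B1Carriers
  Summit.Ventures.HodgeRepro2.T5LandherrGeneralTools Summit.Ventures.HodgeRepro2.T5GlobalRepresentationHM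

/-! ## The induction on the rank, for diagonal forms -/

section Induction

variable {K : Type*} [Field K] [NumberField K] [IsCMField K]

/-- **LANDHERR'S UNIQUENESS FOR DIAGONAL FORMS IN EVERY RANK, FROM O'MEARA 66:1 ALONE** (file 173's proof with
the representation step taken from file 176):** two diagonal hermitian
forms `diag(a)`, `diag(a')` over `K` with coefficients `a, a' : ι → K⁺^×`, congruent at every finite place of `K⁺`
and under every embedding `K → ℂ`, are congruent over `K`. Induction on `#ι`: rank `0` is trivial, rank `1` is the
Hasse norm theorem (file 167); in rank `n ≥ 2`, `diag(a)` represents `c := a'_k` (file 171 — the sign condition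
at a real embedding from Sylvester's counts, file 170), so `diag(a) ≅ ⟨c⟩ ⊥ diag(b)` (files 129 / 130) and
`diag(a') ≅ ⟨c⟩ ⊥ diag(b')`, where `diag(b)`, `diag(b')` are locally congruent everywhere (the determinant class,
file 156) and congruent at every embedding (the counts of positive entries, file 170); induct. -/
theorem isCongruent_diagonal_of_OMeara66_1_of_card (hHM : OMeara1963_66_1 (maximalRealSubfield K)) :
    ∀ (n : ℕ) {ι : Type*} [Fintype ι] [DecidableEq ι], Fintype.card ι = n →
      ∀ {a a' : ι → maximalRealSubfield K}, (∀ i, a i ≠ 0) → (∀ i, a' i ≠ 0) →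
        (∀ v : HeightOneSpectrum (𝓞 (maximalRealSubfield K)),
          LocallyCongruent K v (diagonal fun i => algebraMap (maximalRealSubfield K) K (a i))
            (diagonal fun i => algebraMap (maximalRealSubfield K) K (a' i))) →
        (∀ φ : K →+* ℂ, IsCongruent ((diagonal fun i => algebraMap (maximalRealSubfield K) K (a i)).map φ)
          ((diagonal fun i => algebraMap (maximalRealSubfield K) K (a' i)).map φ)) →
        IsCongruent (diagonal fun i => algebraMap (maximalRealSubfield K) K (a i))
          (diagonal fun i => algebraMap (maximalRealSubfield K) K (a' i)) := by
  intro n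
  induction n using Nat.strong_induction_on with
  | _ n ih =>
    intro ι _ _ hn a a' ha0 ha0' hloc hreal
    rcases Nat.lt_or_ge n 2 with hlt | hge
    · rcases Nat.lt_or_ge n 1 with h0 | h1
      · -- rank `0`
        haveI : IsEmpty ι := Fintype.card_eq_zero_iff.mp (by omega)
        have : (diagonal fun i => algebraMap (maximalRealSubfield K) K (a i)) =
            diagonal fun i => algebraMap (maximalRealSubfield K) K (a' i) := by
          ext i
          exact (IsEmpty.false i).elim
        rw [this]
        exact isCongruent_refl _
      · -- rank `1`: the Hasse norm theorem
        haveI : Unique ι := (Fintype.card_eq_one_iff_nonempty_unique.mp (by omega)).some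
        obtain ⟨z, hz0, hz⟩ := exists_det_eq_mul_norm_of_OMeara66_1 hHM (isHermitian_diagonal_algebraMap a)
          (isHermitian_diagonal_algebraMap a') (isUnit_det_diagonal_algebraMap ha0)
          (isUnit_det_diagonal_algebraMap ha0') hloc hreal
        exact isCongruent_of_unique ⟨z, hz0, by rw [hz, mul_comm z (star z)]⟩
    · -- rank `n ≥ 2`
      haveI : Nonempty ι := Fintype.card_pos_iff.mp (by omega)
      obtain ⟨k⟩ := ‹Nonempty ι›
      set c : maximalRealSubfield K := a' k with hc_def
      have hc0 : c ≠ 0 := ha0' k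
      have hcK : algebraMap (maximalRealSubfield K) K c ≠ 0 := (map_ne_zero _).mpr hc0
      -- (1) `diag(a)` represents `c` over `K`
      obtain ⟨w, hw⟩ : ∃ w : ι → K, ∑ i, algebraMap (maximalRealSubfield K) K (a i) * (w i * star (w i)) =
          algebraMap (maximalRealSubfield K) K c := by
        refine exists_sum_mul_star_eq_of_OMeara66_1 hHM ha0 (by omega) hc0 fun ψ => ?_
        have hφ := hreal (ComplexEmbedding.lift K (Complex.ofRealHom.comp ψ))
        rw [map_diagonal_lift, map_diagonal_lift] at hφ
        have hr : ∀ i, ψ (a i) ≠ 0 := fun i => (map_ne_zero ψ).mpr (ha0 i)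
        have hr' : ∀ i, ψ (a' i) ≠ 0 := fun i => (map_ne_zero ψ).mpr (ha0' i)
        rcases lt_or_gt_of_ne (hr' k) with hk | hk
        · obtain ⟨i, hi⟩ := exists_neg_of_isCongruent_diagonal hr hr' hφ hk
          exact ⟨i, iff_of_false (not_lt.mpr hi.le) (not_lt.mpr hk.le)⟩
        · obtain ⟨i, hi⟩ := exists_pos_of_isCongruent_diagonal hr hr' hφ hk
          exact ⟨i, iff_of_true hi hk⟩
      have hw0 : w ≠ 0 := by
        rintro rfl
        apply hcK
        rw [← hw]
        simp
      -- (2) basis completion and splitting of `diag(a)` at `k`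
      have hDaH : (diagonal fun i => algebraMap (maximalRealSubfield K) K (a i)).IsHermitian :=
        isHermitian_diagonal_algebraMap a
      have hDadet : IsUnit (diagonal fun i => algebraMap (maximalRealSubfield K) K (a i)).det :=
        isUnit_det_diagonal_algebraMap ha0
      obtain ⟨H₁, hH₁, hH₁k⟩ :=
        exists_isCongruent_apply_eq (diagonal fun i => algebraMap (maximalRealSubfield K) K (a i)) hw0 k
      rw [formVal_diagonal, hw] at hH₁k
      have hH₁herm : H₁.IsHermitian := hH₁.isHermitian hDaH
      obtain ⟨S, hS, hsplit⟩ := exists_isCongruent_split hH₁herm k (by rw [hH₁k]; exact hcK)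
      rw [hH₁k] at hsplit
      have hSdet : IsUnit S.det := by
        have h1 := (hH₁.trans hsplit).isUnit_det_iff.mp hDadet
        rw [det_submatrix_equiv_self, det_fromBlocks_unique] at h1
        exact (IsUnit.mul_iff.mp h1).2
      obtain ⟨d, hd, hd0, hSd⟩ := exists_congruent_diagonal_ne_zero one_add_star_one_ne_zero' S hS hSdet
      choose b hb using fun j : {i // ¬ i = k} =>
        (⟨⟨d j, (complexConj_eq_self_iff K (d j)).mp (hd j)⟩, rfl⟩ :
          ∃ b : maximalRealSubfield K, algebraMap (maximalRealSubfield K) K b = d j)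
      have hb0 : ∀ j, b j ≠ 0 := fun j h => hd0 j (by rw [← hb j, h, map_zero])
      have hSdb : IsCongruent S (diagonal fun j => algebraMap (maximalRealSubfield K) K (b j)) := by
        have : (diagonal fun j => algebraMap (maximalRealSubfield K) K (b j)) = diagonal d := by
          congr 1
          funext j
          exact hb j
        rw [this]
        exact hSd
      -- (2') splitting of `diag(a')` at `k`
      have hDaH' : (diagonal fun i => algebraMap (maximalRealSubfield K) K (a' i)).IsHermitian :=
        isHermitian_diagonal_algebraMap a'
      have hDadet' : IsUnit (diagonal fun i => algebraMap (maximalRealSubfield K) K (a' i)).det :=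
        isUnit_det_diagonal_algebraMap ha0'
      obtain ⟨S', hS', hsplit'⟩ := exists_isCongruent_split hDaH' k (by rw [diagonal_apply_eq]; exact hcK)
      rw [diagonal_apply_eq] at hsplit'
      have hSdet' : IsUnit S'.det := by
        have h1 := hsplit'.isUnit_det_iff.mp hDadet'
        rw [det_submatrix_equiv_self, det_fromBlocks_unique] at h1
        exact (IsUnit.mul_iff.mp h1).2
      obtain ⟨d', hd', hd0', hSd'⟩ := exists_congruent_diagonal_ne_zero one_add_star_one_ne_zero' S' hS' hSdet'
      choose b' hb' using fun j : {i // ¬ i = k} =>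
        (⟨⟨d' j, (complexConj_eq_self_iff K (d' j)).mp (hd' j)⟩, rfl⟩ :
          ∃ b : maximalRealSubfield K, algebraMap (maximalRealSubfield K) K b = d' j)
      have hb0' : ∀ j, b' j ≠ 0 := fun j h => hd0' j (by rw [← hb' j, h, map_zero])
      have hSdb' : IsCongruent S' (diagonal fun j => algebraMap (maximalRealSubfield K) K (b' j)) := by
        have : (diagonal fun j => algebraMap (maximalRealSubfield K) K (b' j)) = diagonal d' := by
          congr 1
          funext j
          exact hb' j
        rw [this]
        exact hSd'
      -- (3) the block forms `B`, `B'`, diagonal on `ι`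
      set e : {i // i = k} ⊕ {i // ¬ i = k} ≃ ι := Equiv.sumCompl fun i => i = k with he
      set B : Matrix ι ι K := (fromBlocks (diagonal fun _ : {i // i = k} => algebraMap (maximalRealSubfield K) K c)
        0 0 (diagonal fun j => algebraMap (maximalRealSubfield K) K (b j))).submatrix e.symm e.symm with hB_def
      set B' : Matrix ι ι K := (fromBlocks (diagonal fun _ : {i // i = k} => algebraMap (maximalRealSubfield K) K c)
        0 0 (diagonal fun j => algebraMap (maximalRealSubfield K) K (b' j))).submatrix e.symm e.symm with hB'_def
      have hDaB : IsCongruent (diagonal fun i => algebraMap (maximalRealSubfield K) K (a i)) B :=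
        (hH₁.trans hsplit).trans (isCongruent_submatrix (isCongruent_fromBlocks_of_isCongruent _ hSdb) e.symm)
      have hDaB' : IsCongruent (diagonal fun i => algebraMap (maximalRealSubfield K) K (a' i)) B' :=
        hsplit'.trans (isCongruent_submatrix (isCongruent_fromBlocks_of_isCongruent _ hSdb') e.symm)
      set ã : ι → maximalRealSubfield K := fun i => Sum.elim (fun _ => c) b (e.symm i) with hã
      set ã' : ι → maximalRealSubfield K := fun i => Sum.elim (fun _ => c) b' (e.symm i) with hã'
      have hB : B = diagonal fun i => algebraMap (maximalRealSubfield K) K (ã i) := by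
        rw [hB_def, fromBlocks_diagonal, submatrix_diagonal_equiv]
        congr 1
        funext i
        simp only [Function.comp, hã]
        generalize e.symm i = s
        rcases s with s | j <;> rfl
      have hB' : B' = diagonal fun i => algebraMap (maximalRealSubfield K) K (ã' i) := by
        rw [hB'_def, fromBlocks_diagonal, submatrix_diagonal_equiv]
        congr 1
        funext i
        simp only [Function.comp, hã']
        generalize e.symm i = s
        rcases s with s | j <;> rfl
      have hã0 : ∀ i, ã i ≠ 0 := by
        intro i
        simp only [hã]
        generalize e.symm i = s
        rcases s with s | j
        · exact hc0
        · exact hb0 j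
      have hã0' : ∀ i, ã' i ≠ 0 := by
        intro i
        simp only [hã']
        generalize e.symm i = s
        rcases s with s | j
        · exact hc0
        · exact hb0' j
      -- (4) the hypotheses transported to `B`, `B'`
      have hlocB : ∀ v : HeightOneSpectrum (𝓞 (maximalRealSubfield K)), LocallyCongruent K v B B' := fun v =>
        (locallyCongruent_congr_left v hDaB).mp ((locallyCongruent_congr_right v hDaB').mp (hloc v))
      have hrealB : ∀ φ : K →+* ℂ, IsCongruent (B.map φ) (B'.map φ) := fun φ =>
        ((isCongruent_map_of_isCongruent φ hDaB).symm.trans (hreal φ)).trans (isCongruent_map_of_isCongruent φ hDaB')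
      -- (5) ... to `diag(b)`, `diag(b')`: the finite places, by the determinant class
      obtain ⟨θ, y, hθ, hy⟩ := exists_datum K
      have hlocb : ∀ v : HeightOneSpectrum (𝓞 (maximalRealSubfield K)),
          LocallyCongruent K v (diagonal fun j => algebraMap (maximalRealSubfield K) K (b j))
            (diagonal fun j => algebraMap (maximalRealSubfield K) K (b' j)) := by
        intro v
        have hpb0 : (∏ j, b j) ≠ 0 := Finset.prod_ne_zero_iff.mpr fun j _ => hb0 j
        have hpb0' : (∏ j, b' j) ≠ 0 := Finset.prod_ne_zero_iff.mpr fun j _ => hb0' j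
        have hdb : (diagonal fun j => algebraMap (maximalRealSubfield K) K (b j)).det =
            algebraMap (maximalRealSubfield K) K (∏ j, b j) := by
          rw [det_diagonal, map_prod]
        have hdb' : (diagonal fun j => algebraMap (maximalRealSubfield K) K (b' j)).det =
            algebraMap (maximalRealSubfield K) K (∏ j, b' j) := by
          rw [det_diagonal, map_prod]
        have hr0 : (∏ j, b' j) / (∏ j, b j) ≠ 0 := div_ne_zero hpb0' hpb0
        have hratio : (diagonal fun j => algebraMap (maximalRealSubfield K) K (b' j)).det =
            algebraMap (maximalRealSubfield K) K ((∏ j, b' j) / (∏ j, b j)) *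
              (diagonal fun j => algebraMap (maximalRealSubfield K) K (b j)).det := by
          rw [hdb, hdb', map_div₀, div_mul_cancel₀ _ ((map_ne_zero _).mpr hpb0)]
        have hdetB : B.det = algebraMap (maximalRealSubfield K) K c *
            (diagonal fun j => algebraMap (maximalRealSubfield K) K (b j)).det := by
          rw [hB_def, det_submatrix_equiv_self, det_fromBlocks_unique]
        have hdetB' : B'.det = algebraMap (maximalRealSubfield K) K c *
            (diagonal fun j => algebraMap (maximalRealSubfield K) K (b' j)).det := by
          rw [hB'_def, det_submatrix_equiv_self, det_fromBlocks_unique]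
        have hratioB : B'.det = algebraMap (maximalRealSubfield K) K ((∏ j, b' j) / (∏ j, b j)) * B.det := by
          rw [hdetB, hdetB', hratio]
          ring
        have hBH : B.IsHermitian := by
          rw [hB]
          exact isHermitian_diagonal_algebraMap ã
        have hBH' : B'.IsHermitian := by
          rw [hB']
          exact isHermitian_diagonal_algebraMap ã'
        have hBdet : IsUnit B.det := by
          rw [hB]
          exact isUnit_det_diagonal_algebraMap hã0
        have hBdet' : IsUnit B'.det := by
          rw [hB']
          exact isUnit_det_diagonal_algebraMap hã0'
        have h1 := (hilbertFin_eq_one_iff_locallyCongruent hθ hy v hBH hBH' hBdet hBdet' hr0 hratioB).mpr (hlocB v)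
        exact (hilbertFin_eq_one_iff_locallyCongruent hθ hy v (isHermitian_diagonal_algebraMap b)
          (isHermitian_diagonal_algebraMap b') (isUnit_det_diagonal_algebraMap hb0)
          (isUnit_det_diagonal_algebraMap hb0') hr0 hratio).mp h1
      -- (6) ... the real places, by the counts of positive entries
      have hrealb : ∀ φ : K →+* ℂ,
          IsCongruent ((diagonal fun j => algebraMap (maximalRealSubfield K) K (b j)).map φ)
            ((diagonal fun j => algebraMap (maximalRealSubfield K) K (b' j)).map φ) := by
        intro φ
        set ψ : maximalRealSubfield K →+* ℝ :=
          (IsTotallyReal.complexEmbedding_isReal (φ.comp (algebraMap (maximalRealSubfield K) K))).embedding with hψ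
        have hφB := hrealB φ
        rw [hB, hB', map_diagonal_embedding, map_diagonal_embedding] at hφB
        rw [map_diagonal_embedding, map_diagonal_embedding]
        have hrã : ∀ i, ψ (ã i) ≠ 0 := fun i => (map_ne_zero ψ).mpr (hã0 i)
        have hrã' : ∀ i, ψ (ã' i) ≠ 0 := fun i => (map_ne_zero ψ).mpr (hã0' i)
        have hcount := card_pos_eq_of_isCongruent_diagonal hrã hrã' hφB
        -- split the counts along `e`
        have hsplitc : ∀ (g : {i // ¬ i = k} → maximalRealSubfield K),
            (univ.filter fun i => 0 < ψ (Sum.elim (fun _ => c) g (e.symm i))).card =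
              (univ.filter fun _ : {i // i = k} => 0 < ψ c).card + (univ.filter fun j => 0 < ψ (g j)).card := by
          intro g
          have h1 := card_filter_pos_comp_equiv e.symm (fun s => ψ (Sum.elim (fun _ => c) g s))
          have h3 : (univ.filter fun s : {i // i = k} ⊕ {i // ¬ i = k} => 0 < ψ (Sum.elim (fun _ => c) g s)) =
              univ.filter fun s => 0 < Sum.elim (fun _ : {i // i = k} => ψ c) (fun j => ψ (g j)) s := by
            refine Finset.filter_congr fun s _ => ?_
            rcases s with s | j <;> rfl
          rw [h1, h3, card_filter_pos_sum_elim]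
        simp only [hã, hã'] at hcount
        rw [hsplitc b, hsplitc b'] at hcount
        have hcount' : (univ.filter fun j => 0 < ψ (b j)).card = (univ.filter fun j => 0 < ψ (b' j)).card := by
          omega
        exact isCongruent_diagonal_of_card_pos_eq (fun j => (map_ne_zero ψ).mpr (hb0 j))
          (fun j => (map_ne_zero ψ).mpr (hb0' j)) hcount'
      -- (7) induction on the complement, and assembly
      have hcard' : Fintype.card {i // ¬ i = k} = n - 1 := by
        rw [Fintype.card_subtype_compl, Fintype.card_subtype_eq, hn]
      have hbb' := ih (n - 1) (by omega) hcard' hb0 hb0' hlocb hrealb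
      have hBB' : IsCongruent B B' :=
        isCongruent_submatrix (isCongruent_fromBlocks_of_isCongruent _ hbb') e.symm
      exact (hDaB.trans hBB').trans hDaB'.symm

/-- **LANDHERR'S THEOREM (UNIQUENESS) IN EVERY RANK FROM O'MEARA 66:1 ALONE** (file 173's proof on file 176's
representation theorem):** `GrossBH2021_Thm3_1_uniqueness K n`
for every finite index type `n` — two invertible hermitian Gram matrices over the CM field `K`, congruent at every
finite place of `K⁺` and under every embedding `K → ℂ`, are congruent over `K`. Diagonalise both (file 129, entries
in `K⁺`), transport the hypotheses along the two congruences, and apply the diagonal case. -/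
theorem grossBH2021_of_OMeara66_1 (hHM : OMeara1963_66_1 (maximalRealSubfield K))
    (n : Type*) [Fintype n] [DecidableEq n] :
    GrossBH2021_Thm3_1_uniqueness K n := by
  intro H H' hH hH' hdet hdet' hloc hreal
  obtain ⟨d, hd, hd0, hHd⟩ := exists_congruent_diagonal_ne_zero one_add_star_one_ne_zero' H hH hdet
  obtain ⟨d', hd', hd0', hHd'⟩ := exists_congruent_diagonal_ne_zero one_add_star_one_ne_zero' H' hH' hdet'
  choose a ha using fun i : n =>
    (⟨⟨d i, (complexConj_eq_self_iff K (d i)).mp (hd i)⟩, rfl⟩ :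
      ∃ a : maximalRealSubfield K, algebraMap (maximalRealSubfield K) K a = d i)
  choose a' ha' using fun i : n =>
    (⟨⟨d' i, (complexConj_eq_self_iff K (d' i)).mp (hd' i)⟩, rfl⟩ :
      ∃ a : maximalRealSubfield K, algebraMap (maximalRealSubfield K) K a = d' i)
  have hda : diagonal d = diagonal fun i => algebraMap (maximalRealSubfield K) K (a i) := by
    congr 1
    funext i
    exact (ha i).symm
  have hda' : diagonal d' = diagonal fun i => algebraMap (maximalRealSubfield K) K (a' i) := by
    congr 1
    funext i
    exact (ha' i).symm
  rw [hda] at hHd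
  rw [hda'] at hHd'
  have ha0 : ∀ i, a i ≠ 0 := fun i h => hd0 i (by rw [← ha i, h, map_zero])
  have ha0' : ∀ i, a' i ≠ 0 := fun i h => hd0' i (by rw [← ha' i, h, map_zero])
  have hloc' : ∀ v : HeightOneSpectrum (𝓞 (maximalRealSubfield K)),
      LocallyCongruent K v (diagonal fun i => algebraMap (maximalRealSubfield K) K (a i))
        (diagonal fun i => algebraMap (maximalRealSubfield K) K (a' i)) := fun v =>
    (locallyCongruent_congr_left v hHd).mp ((locallyCongruent_congr_right v hHd').mp (hloc v))
  have hreal' : ∀ φ : K →+* ℂ,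
      IsCongruent ((diagonal fun i => algebraMap (maximalRealSubfield K) K (a i)).map φ)
        ((diagonal fun i => algebraMap (maximalRealSubfield K) K (a' i)).map φ) := fun φ =>
    ((isCongruent_map_of_isCongruent φ hHd).symm.trans (hreal φ)).trans (isCongruent_map_of_isCongruent φ hHd')
  exact (hHd.trans (isCongruent_diagonal_of_OMeara66_1_of_card hHM _ rfl ha0 ha0' hloc' hreal')).trans hHd'.symm

end Induction

end Summit.Ventures.HodgeRepro2.T5LandherrGeneralHM
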